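import Summits.Ventures.YMGap.Thresholds.StarChartZd
import Literature.MathematicalPhysics.QuantumFieldTheory.Balaban1983to89.InfiniteVolumeSufficient
import HarnessLib

/-!
# Venture YMGap — track (c) «DS»: TRANSFER of the vertex-star window bound from the torus
# `(ℤ/L)^d` (`L ≥ 5`) to the infinite lattice `ℤ^d`, and the infinite-volume uniqueness row

HONEST FRAMING: venture file (cell `pub-ymgap`, PLAN R101–R103), strong-coupling LATTICE statement;
nothing about the continuum, confinement at weak coupling, or the mass gap. Part 2 of the chart files
(`StarChartZd.lean` = the kernel identity). The cell's Lemma G (`starWindowBound_lemmaG`, ds-4) delivers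
the star window bound `DSWindow.StarWindowBound L β_W ρ r` on every torus of side `L ≥ 3`; by the chart
identity `integral_ymSpecification_vertexStarZd_eq_torus` the torus window bound on ONE torus of side
`L ≥ 5` transfers verbatim to the `ℤ^d` schema `StarWindowBoundZd` of `StarUniquenessZd.lean`
(`starWindowBoundZd_of_isLinkWindowContraction`, `starWindowBoundZd_of_starWindowBound`), and the
infinite-volume door gives

  `su2_hasUniqueGibbsMeasure_of_starWindowBound : 5 ≤ L → StarWindowBound L β_W ρ suFrobDist → ρ < 1 →
     HasUniqueGibbsMeasure (ymSpecification (fundamentalRep (Fin 2)) (2 · (β_W/4)))`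

— the uniqueness clause of the tree's SC-a currency `DLRMassGapAt 4 2 (β_W/4)`, conditional on exactly
the torus hypothesis the cell's Lemma G proves (at `L = 5`, `β_W ≤ 1/2`, `ρ = R_G(β_W)`; `R_G < 1` iff
`β_W < 0.3609…`). NOTHING is asserted here about that hypothesis. (The clustering half,
`DLRMassGapAt 4 2 (β_W/4)`, is `StarClusteringZd.su2_dlrMassGapAt_of_starWindowBound`.)

References: H.-O. Georgii (2011) (2.15), Thm. 4.17; R. L. Dobrushin, S. B. Shlosman (1985) Thm. 1; cell
files `LEAN-KROW.md` (ds-1), `B4-BLUEPRINT.md` (ds-4).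
-/

noncomputable section

open MeasureTheory ProbabilityTheory Function Finset
open Literature.Probability.LatticeModels
open Literature.Probability.LatticeModels.DobrushinMetric (IsLipBound)
open Literature.MathematicalPhysics.QuantumLattice
open Literature.MathematicalPhysics.QuantumFieldTheory (Edge GaugeConfig Plaquette plaquetteHolonomy
  torusWeightSpec haarProbability plaqEdgesT suFrobDist suFrobDist_nonneg)
open Literature.MathematicalPhysics.QuantumFieldTheory.Balaban1983to89.StrongCouplingTorusWindow
  (wilsonPlaqWeight continuous_wilsonPlaqWeight)
open Summit.Ventures.YMGap.DSWindow (linkEnds mem_linkEnds vertexStar mem_vertexStar starWin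
  IsLinkWindowContraction StarWindowBound)
open Summit.Ventures.YMGap.StarKernel (starPlaqs mem_starPlaqs starLogWeight
  integral_torusWeightSpec_vertexStar)

namespace Summit.Ventures.YMGap.DSWindowZd

variable {d L : ℕ}

/-! ### Transfer of the window bound, and the infinite-volume uniqueness row -/

section Transfer

variable {N : ℕ} [NeZero L]

/-- **TRANSFER OF THE STAR WINDOW BOUND, torus → `ℤ^d`.** If on the torus `(ℤ/L)^d`, `L ≥ 5`, the star
windows of the `SU(N)` Wilson plaquette-weight specification at bare coupling `β` satisfy the window
contraction (H1) `IsLinkWindowContraction` with a vertex-indexed array `K̄ ≥ 0` and per-star received sums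
`≤ ρ`, for a nonnegative group weight `r`, then the `ℤ^d` schema `StarWindowBoundZd d N β ρ r` holds, with
the array `K(s; y → x) = K̄(proj s; proj y → proj x)` for `y` in the locality set of the star and `0`
otherwise. For `y` off the locality set the `ℤ^d` kernel does not see `y` (quasilocality); on it, the two
exteriors are transported to the torus through a local section of the chart and the chart identity
applies. -/
theorem starWindowBoundZd_of_isLinkWindowContraction (hL : 5 ≤ L) {β ρ : ℝ}
    {r : (Matrix.specialUnitaryGroup (Fin N) ℂ) → (Matrix.specialUnitaryGroup (Fin N) ℂ) → ℝ} (hr0 : ∀ a b, 0 ≤ r a b)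
    {Kt : Literature.MathematicalPhysics.QuantumFieldTheory.Site d L → Edge d L → Edge d L → ℝ}
    (hKt0 : ∀ t y x, 0 ≤ Kt t y x)
    (hH1 : IsLinkWindowContraction (d := d) (L := L) (wilsonPlaqWeight N β) r starWin fun c => Kt c.1)
    (hH2 : ∀ (t : Literature.MathematicalPhysics.QuantumFieldTheory.Site d L) (x : Edge d L),
      x ∈ vertexStar t → ∑ y, Kt t y x ≤ ρ) :
    StarWindowBoundZd d N β ρ r := by
  classical
  -- `SU(N) ⊆ M_N(ℂ)` is second countable
  haveI : SecondCountableTopology (Matrix (Fin N) (Fin N) ℂ) :=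
    inferInstanceAs (SecondCountableTopology (Fin N → Fin N → ℂ))
  haveI : SecondCountableTopology (Matrix.specialUnitaryGroup (Fin N) ℂ) := Topology.IsEmbedding.subtypeVal.secondCountableTopology
  refine ⟨fun s y x => if y ∈ starNbhdZd s then
      Kt (Torus.proj L s) (torusEdge L y) (torusEdge L x) else 0, ?_, ?_, ?_, ?_⟩
  · -- nonnegativity
    intro s y x
    dsimp only
    split_ifs
    · exact hKt0 _ _ _
    · exact le_rfl
  · -- support in the locality set
    intro s y x h
    by_contra hy
    exact h (if_neg hy)
  · -- (H1)
    intro c y hyc ω η hωη f δ hfm hfb hfdep hδ0 hδ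
    set s : Site d := c.1 with hs
    have hstar : starWinZd c = vertexStarZd s := rfl
    by_cases hyN : y ∈ starNbhdZd s
    swap
    · -- off the locality set: the kernel does not see `y`, the array vanishes
      have heq : ∫ σ, f σ ∂(ymSpecification (d := d) (fundamentalRep (Fin N)) β (starWinZd c) ω) =
          ∫ σ, f σ ∂(ymSpecification (d := d) (fundamentalRep (Fin N)) β (starWinZd c) η) :=
        dependsOn_integral_ymSpecification (fundamentalRep (Fin N)) (continuous_fundamentalRep (Fin N))
          β (starWinZd c) hfm hfdep fun v hv => hωη v (by
            rintro rfl
            exact hyN (Finset.mem_coe.1 hv))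
      rw [heq, sub_self, abs_zero]
      refine mul_nonneg (Finset.sum_nonneg fun x _ => mul_nonneg ?_ (hδ0 x)) (hr0 _ _)
      simp only [if_neg hyN, le_refl]
    -- on the locality set: transport to the torus of side `L`
    haveI : Nonempty (ZdEdge d) := ⟨c⟩
    have hinjN := injOn_torusEdge_starNbhdZd hL s
    have hΛN : vertexStarZd s ⊆ starNbhdZd s := vertexStarZd_subset_starNbhdZd s
    set lift : Edge d L → ZdEdge d := Function.invFunOn (torusEdge L) ↑(starNbhdZd s) with hlift_def
    have hlift : ∀ e ∈ starNbhdZd s, lift (torusEdge L e) = e := fun e he =>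
      hinjN.leftInvOn_invFunOn (Finset.mem_coe.2 he)
    -- the transported exteriors
    set ω' : GaugeConfig d L (Matrix.specialUnitaryGroup (Fin N) ℂ) := fun e' => ω (lift e') with hω'_def
    set η' : GaugeConfig d L (Matrix.specialUnitaryGroup (Fin N) ℂ) := Function.update ω' (torusEdge L y) (η y) with hη'_def
    have hω' : ∀ e ∈ starNbhdZd s, ω' (torusEdge L e) = ω e := fun e he => by
      simp only [hω'_def, hlift e he]
    have hη' : ∀ e ∈ starNbhdZd s, η' (torusEdge L e) = η e := by
      intro e he
      simp only [hη'_def]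
      by_cases hey : torusEdge L e = torusEdge L y
      · have : e = y := hinjN he hyN hey
        subst this
        rw [Function.update_self]
      · rw [Function.update_of_ne hey, hω' e he]
        exact hωη e fun h => hey (h ▸ rfl)
    have hω'η' : ∀ e', e' ≠ torusEdge L y → ω' e' = η' e' := fun e' he' => by
      simp only [hη'_def, Function.update_of_ne he']
    -- the transported centre, boundary link, observable and Lipschitz vector
    set c' : Edge d L := torusEdge L c with hc'_def
    have hc'1 : c'.1 = Torus.proj L s := rfl
    have hwin' : starWin c' = (vertexStarZd s).image (torusEdge L) := by
      rw [image_torusEdge_vertexStarZd]; rfl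
    have hy' : torusEdge L y ∉ starWin c' := by
      rw [hwin']
      intro hmem
      obtain ⟨x, hx, hxy⟩ := Finset.mem_image.1 hmem
      exact hyc (hstar ▸ (hinjN (hΛN hx) hyN hxy ▸ hx))
    set f' : GaugeConfig d L (Matrix.specialUnitaryGroup (Fin N) ℂ) → ℝ := fun V => f (torusLift L V) with hf'_def
    have hf'm : Measurable f' := hfm.comp measurable_torusLift'
    have hf'b : ∃ B, ∀ V, |f' V| ≤ B := hfb.imp fun B hB V => hB _
    have hf'dep : DependsOn f' (↑(starWin c') : Set (Edge d L)) := by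
      intro V V' hVV'
      simp only [hf'_def]
      refine hfdep fun e he => ?_
      simp only [torusLift, Function.comp_apply]
      exact hVV' _ (Finset.mem_coe.2 (hwin' ▸ Finset.mem_image_of_mem _ (Finset.mem_coe.1 he)))
    set δ' : Edge d L → ℝ := fun e' => δ (lift e') with hδ'_def
    have hδ'0 : ∀ x, 0 ≤ δ' x := fun x => hδ0 _
    have hf'lip : ∀ (x : Edge d L) (V V' : GaugeConfig d L (Matrix.specialUnitaryGroup (Fin N) ℂ)), (∀ e, e ≠ x → V e = V' e) →
        |f' V - f' V'| ≤ δ' x * r (V x) (V' x) := by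
      intro x V V' hVV'
      simp only [hf'_def]
      by_cases hx : x ∈ (vertexStarZd s).image (torusEdge L)
      · obtain ⟨x₀, hx₀, rfl⟩ := Finset.mem_image.1 hx
        have key : f (torusLift L V) =
            f (Function.update (torusLift L V') x₀ (V (torusEdge L x₀))) := by
          refine hfdep fun e he => ?_
          by_cases hex : e = x₀
          · subst hex
            simp [torusLift]
          · rw [Function.update_of_ne hex]
            simp only [torusLift, Function.comp_apply]
            refine hVV' _ fun h => hex ?_
            exact hinjN (hΛN (Finset.mem_coe.1 he)) (hΛN hx₀) h
        rw [key]
        have h := hδ x₀ (Function.update (torusLift L V') x₀ (V (torusEdge L x₀))) (torusLift L V')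
          fun v hv => by rw [Function.update_of_ne hv]
        rw [Function.update_self] at h
        simp only [torusLift, Function.comp_apply] at h
        have hδx : δ' (torusEdge L x₀) = δ x₀ := by simp only [hδ'_def, hlift x₀ (hΛN hx₀)]
        rw [hδx]
        exact h
      · have : f (torusLift L V) = f (torusLift L V') := by
          refine hfdep fun e he => ?_
          simp only [torusLift, Function.comp_apply]
          exact hVV' _ fun h => hx (h ▸ Finset.mem_image_of_mem _ (Finset.mem_coe.1 he))
        rw [this, sub_self, abs_zero]
        exact mul_nonneg (hδ'0 _) (hr0 _ _)
    -- the torus window bound for the transported data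
    have key := hH1 c' (torusEdge L y) hy' ω' η' hω'η' f' δ' hf'm hf'b hf'dep hδ'0 hf'lip
    -- read it back through the chart
    have hωint : ∫ σ, f σ ∂(ymSpecification (d := d) (fundamentalRep (Fin N)) β (starWinZd c) ω) =
        ∫ V, f' V ∂(torusWeightSpec (wilsonPlaqWeight N β) (starWin c') ω') :=
      integral_ymSpecification_vertexStarZd_eq_torus hL β s ω ω' hω' hfm hfdep
    have hηint : ∫ σ, f σ ∂(ymSpecification (d := d) (fundamentalRep (Fin N)) β (starWinZd c) η) =
        ∫ V, f' V ∂(torusWeightSpec (wilsonPlaqWeight N β) (starWin c') η') :=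
      integral_ymSpecification_vertexStarZd_eq_torus hL β s η η' hη' hfm hfdep
    have hry : r (ω' (torusEdge L y)) (η' (torusEdge L y)) = r (ω y) (η y) := by
      rw [hω' y hyN, hη' y hyN]
    have hsum : ∑ x ∈ starWin c', Kt c'.1 (torusEdge L y) x * δ' x =
        ∑ x ∈ starWinZd c, (if y ∈ starNbhdZd c.1 then
          Kt (Torus.proj L c.1) (torusEdge L y) (torusEdge L x) else 0) * δ x := by
      rw [hwin', Finset.sum_image fun a ha b hb h => hinjN (hΛN ha) (hΛN hb) h]
      refine Finset.sum_congr rfl fun x hx => ?_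
      rw [← hs, if_pos hyN, hc'1]
      simp only [hδ'_def, hlift x (hΛN hx)]
    rw [hωint, hηint, ← hry, ← hsum]
    exact key
  · -- (H2)
    intro s x hx
    have hinjN := injOn_torusEdge_starNbhdZd hL s
    have hx' : torusEdge L x ∈ vertexStar (Torus.proj L s) := torusEdge_mem_vertexStar_proj hx
    have h1 : ∑ y ∈ starNbhdZd s, (if y ∈ starNbhdZd s then
          Kt (Torus.proj L s) (torusEdge L y) (torusEdge L x) else 0) =
        ∑ y ∈ starNbhdZd s, Kt (Torus.proj L s) (torusEdge L y) (torusEdge L x) :=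
      Finset.sum_congr rfl fun y hy => if_pos hy
    have h2 : ∑ y ∈ (starNbhdZd s).image (torusEdge L), Kt (Torus.proj L s) y (torusEdge L x) =
        ∑ y ∈ starNbhdZd s, Kt (Torus.proj L s) (torusEdge L y) (torusEdge L x) :=
      Finset.sum_image fun a ha b hb h => hinjN ha hb h
    have h3 : ∑ y ∈ (starNbhdZd s).image (torusEdge L), Kt (Torus.proj L s) y (torusEdge L x) ≤
        ∑ y, Kt (Torus.proj L s) y (torusEdge L x) :=
      Finset.sum_le_sum_of_subset_of_nonneg (Finset.subset_univ _) fun y _ _ => hKt0 _ _ _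
    show ∑ y ∈ starNbhdZd s, (if y ∈ starNbhdZd s then
          Kt (Torus.proj L s) (torusEdge L y) (torusEdge L x) else 0) ≤ ρ
    rw [h1, ← h2]
    exact h3.trans (hH2 _ _ hx')

/-- **The cell's torus schema transfers**: `StarWindowBound L β_W ρ r` (`SU(2)`, `d = 4`, tree coupling
`β_W/2`) on a torus of side `L ≥ 5` gives the `ℤ^4` schema at bare coupling `β_W/2`. -/
theorem starWindowBoundZd_of_starWindowBound (hL : 5 ≤ L) {βW ρ : ℝ}
    {r : (Matrix.specialUnitaryGroup (Fin 2) ℂ) → (Matrix.specialUnitaryGroup (Fin 2) ℂ) → ℝ} (hr0 : ∀ a b, 0 ≤ r a b) (h : StarWindowBound L βW ρ r) :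
    StarWindowBoundZd 4 2 (βW / 2) ρ r := by
  obtain ⟨Kt, hKt0, -, hH1, hH2⟩ := h
  exact starWindowBoundZd_of_isLinkWindowContraction hL hr0 hKt0 hH1 hH2

/-- **Infinite-volume uniqueness from a torus star window bound, `SU(N)`, any `d`.** A star window
contraction on ONE torus of side `L ≥ 5` with per-star received sums `≤ ρ < 1` for the Frobenius weight
makes the `SU(N)` lattice Yang–Mills DLR state on `ℤ^d` at the same bare coupling unique. -/
theorem hasUniqueGibbsMeasure_of_isLinkWindowContraction (hL : 5 ≤ L) {β ρ : ℝ} (hρ0 : 0 ≤ ρ)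
    (hρ1 : ρ < 1)
    {Kt : Literature.MathematicalPhysics.QuantumFieldTheory.Site d L → Edge d L → Edge d L → ℝ}
    (hKt0 : ∀ t y x, 0 ≤ Kt t y x)
    (hH1 : IsLinkWindowContraction (d := d) (L := L) (wilsonPlaqWeight N β) suFrobDist starWin
      fun c => Kt c.1)
    (hH2 : ∀ (t : Literature.MathematicalPhysics.QuantumFieldTheory.Site d L) (x : Edge d L),
      x ∈ vertexStar t → ∑ y, Kt t y x ≤ ρ) :
    HasUniqueGibbsMeasure (ymSpecification (d := d) (fundamentalRep (Fin N)) β) :=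
  hasUniqueGibbsMeasure_of_starWindowBoundZd β hρ0 hρ1
    (starWindowBoundZd_of_isLinkWindowContraction hL suFrobDist_nonneg hKt0 hH1 hH2)

/-- **`SU(2)`, `d = 4`: INFINITE-VOLUME DLR UNIQUENESS FROM THE CELL'S TORUS STAR BOUND.** If
`StarWindowBound L β_W ρ suFrobDist` holds on some torus of side `L ≥ 5` with `ρ < 1` (the cell's Lemma G
gives it for every `L ≥ 3`, `0 ≤ β_W ≤ 1/2`, with `ρ = R_G(β_W)`, `< 1` for `β_W ≤ 9/25`), then the
`SU(2)` lattice Yang–Mills specification on `ℤ^4` at 't Hooft coupling `β_W/4` (bare `β_W/2`) has EXACTLY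
ONE DLR state — the uniqueness clause of `DLRMassGapAt 4 2 (β_W/4)`, the currency of the tree's
single-link fronts (`su2_dlrMassGapAt_ninth`, `…_124`, `β_W < 2/9`-class). -/
theorem su2_hasUniqueGibbsMeasure_of_starWindowBound (hL : 5 ≤ L) (βW : ℝ) {ρ : ℝ} (hρ0 : 0 ≤ ρ)
    (hρ1 : ρ < 1) (h : StarWindowBound L βW ρ suFrobDist) :
    HasUniqueGibbsMeasure (ymSpecification (d := 4) (fundamentalRep (Fin 2)) ((2 : ℕ) * (βW / 4))) := by
  have e : ((2 : ℕ) : ℝ) * (βW / 4) = βW / 2 := by push_cast; ring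
  rw [e]
  exact hasUniqueGibbsMeasure_of_starWindowBoundZd _ hρ0 hρ1
    (starWindowBoundZd_of_starWindowBound hL suFrobDist_nonneg h)

/-- **The thermodynamic limit exists and is unique** (`HasUniqueInfiniteVolumeLimit`: the FULL sequence of torus
Wilson states converges on bounded continuous cylinder observables and has exactly one limit point —
Osterwalder–Seiler 1978 §4 currency): from the `ℤ^d` star window bound with `ρ < 1`, via DLR uniqueness
(`hasUniqueGibbsMeasure_of_starWindowBoundZd`) and the tree's `hasUniqueInfiniteVolumeLimit_of_subsingleton`
(limit points exist and are DLR states). -/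
theorem hasUniqueInfiniteVolumeLimit_of_starWindowBoundZd (β : ℝ) {ρ : ℝ} (hρ0 : 0 ≤ ρ) (hρ1 : ρ < 1)
    (h : StarWindowBoundZd d N β ρ suFrobDist) :
    HasUniqueInfiniteVolumeLimit (d := d) (fundamentalRep (Fin N)) β := by
  haveI : SecondCountableTopology (Matrix (Fin N) (Fin N) ℂ) :=
    inferInstanceAs (SecondCountableTopology (Fin N → Fin N → ℂ))
  haveI : SecondCountableTopology (Matrix.specialUnitaryGroup (Fin N) ℂ) := Topology.IsEmbedding.subtypeVal.secondCountableTopology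
  exact hasUniqueInfiniteVolumeLimit_of_subsingleton (fundamentalRep (Fin N))
    (continuous_fundamentalRep (Fin N)) β (hasUniqueGibbsMeasure_of_starWindowBoundZd β hρ0 hρ1 h).1

/-- **`SU(2)`, `d = 4`: the torus Wilson states CONVERGE, to the unique DLR state**, at tree coupling `β_W/2`,
whenever `StarWindowBound L β_W ρ suFrobDist` holds on one torus of side `L ≥ 5` with `ρ < 1`
(Osterwalder–Seiler §4 currency `HasUniqueInfiniteVolumeLimit`). -/
theorem su2_hasUniqueInfiniteVolumeLimit_of_starWindowBound (hL : 5 ≤ L) (βW : ℝ) {ρ : ℝ}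
    (hρ0 : 0 ≤ ρ) (hρ1 : ρ < 1) (h : StarWindowBound L βW ρ suFrobDist) :
    HasUniqueInfiniteVolumeLimit (d := 4) (fundamentalRep (Fin 2)) (βW / 2) :=
  hasUniqueInfiniteVolumeLimit_of_starWindowBoundZd (βW / 2) hρ0 hρ1
    (starWindowBoundZd_of_starWindowBound hL suFrobDist_nonneg h)

end Transfer

end Summit.Ventures.YMGap.DSWindowZd

end
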